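import Summits.RiemannHypothesis.RiemannHypothesis.Theorems.Splittings.LiRephasingGainBudget
import HarnessLib

/-!
# LI B18 KERNEL Q2/6 — THE ONE-STEP RE-PHASING THEOREM (THEOREM A-fin), FLOOR VIOLATIONS, COUNTING INVISIBILITY (SketchG16B §§4–6) — RH-FREE

PRE-CUT (not filed).  Lane (xi-q) «LI B18 KERNEL» ×6 = Q1 `LiRephasingGainBudget` → Q2 `LiOneStepRephasing` → Q3 `LiRephasingSchedule` →
Q4 `LiRephasingScales` → Q5 `LiRephasingMovingCutPrelim` → Q6 `LiRephasingMovingCut` RESERVED by RULING #204 (rh-split lead g6,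
2026-08-27T18:03:10Z): GO = (xi-p) `LiRephasingKit` ACCEPTED (p553624, 18:01:43Z) + referee g8 BYTES and negctl replay on the six carved shas;
LOWEST priority; filing words `--supports stmt-RiemannHypothesis-19649 --as helper`, kind auto, parts land in chain order.  Cell rh-split,
seat rh-split-li-bridge (kernel author g16, cutter g17; brief sha16 f79c5f09d8bcb036), card `run/shared/lean/pub/rh-split/cards/SPLIT-li-bridge.md`
§23 / 23.8 (model barrier B18 «INCREMENT-LEVEL RE-PHASING ⟂ COUNTING-LAW BRIDGES»).  Kernel source `HOME/rh-split-li-bridge/SketchG16B.lean`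
sha16 cf2b65fdbda323e2 (1639 l, ns `RhSplit.LiBridgeG16`, farm rc 0 · 0 err · 0 warn · 0 sorry, std axioms; §§1–6 = `SketchG16.lean`
355f955084e6fc2c byte-identical prefix, referee REPLAY PASS 17:02Z / RULING #176; §§7–9 referee REPLAY PASS 17:28:47Z / RULING #186);
cut plan `CARVE-16.md` 677f9696f1bd3382; reconstruction note `HOME/rh-split-li-bridge/carve-16/README.md` (CUT ONLY — no regeneration).
THIS PART = scratch ll.395–669 (§4, §5, §6)
↦ ll.51–325 here; decl text BYTE-VERBATIM (statements AND proofs, scratch section headers kept).  Deltas = namespace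
`RhSplit.LiBridgeG16` ↦ `Summit.RiemannHypothesis.RiemannHypothesis.Theorems.Splittings.LiOneStepRephasing`, imports (Q1 `…Splittings.LiRephasingGainBudget` + HarnessLib),
this header, `set_option linter.dupNamespace false`, the `open` lines (the scratch's + `…Splittings.LiRephasingKit` + the earlier parts'
namespaces).  The six SketchG15B lemmas of scratch §1 (`exists_sin_eq_neg_one_of_phase_drop`, `four_sin_half_mul_sin`,
`sum_range_phase_telescope`, `abs_sum_range_phase_le`, `abs_sum_range_family_le`, `exists_le_on_block`) are CITED from the tree's
`LiRephasingKit` (lane (xi-p)), never restated.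

Content: §4 **`one_step`** (THEOREM A-fin, RH-FREE): for ANY base assignment `g₀`, `0 ≤ T ≤ T' ≤ Y`, `0 < m`, `0 < N`, `16πT' ≤ N`,
some `n ∈ [N, 2N)`, some class `c < m` and a re-phasing `g` (= `g₀` off `sel Z m c`, `Z = zerosBetween T T'`; each selected TRUE
ordinate moved DOWN by `≤ 4πγ²/(n+½)`) give `lowSumRe g n Y ≤ 4·(Σ_{0<γ≤Y} m_ρ)/N − (1/m)·Σ_{ρ∈Z} m_ρ·4 sin(θ_γ/2)`; §5 with the
gain budget: `one_step_budget`, `floor_violation`, `floor_violation_log` (floor `K − ½ log n`), displacement sizes `disp_le_spacing_div`,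
`disp_le_one`, the cut-raising bound `lowSumRe_cut_le`; §6 `countRe` and `countRe_squeeze` (a re-phasing lowering ordinates by `≤ 1`
moves the configuration's counting function by at most one unit window `≤ 3 log(t+2)`).  1 def, 10 theorems.

HONEST LABEL: SPLITTING SEARCH over kernel-typed RH-EQUIVALENCES; a splitting A ∧ B ⟹ RH is CONDITIONAL bookkeeping
unless A and B are both proved; nothing here bears on the truth of RH.  Every theorem below is PURE (trigonometry /
finite sums / calculus / parameter arithmetic) or RH-FREE (about the true zeta zeros, no hypothesis on their real parts);
none is a claim about RH, PL or K7ev; the whole chain is BARRIER-SIDE bookkeeping (B18), not a conjunct toward RH.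
-/

set_option linter.dupNamespace false

namespace Summit.RiemannHypothesis.RiemannHypothesis.Theorems.Splittings.LiOneStepRephasing

open Real Set Finset
open Literature.NumberTheory.LFunctions Literature.NumberTheory.LFunctions.SchoenfeldBound
open Literature.NumberTheory.LFunctions.AlpogeFurman2026
open Literature.NumberTheory.LFunctions.SoundTest
open Summit.RiemannHypothesis.RiemannHypothesis.Theorems.LiTheory
open Summit.RiemannHypothesis.RiemannHypothesis.Theorems.Splittings
open Summit.RiemannHypothesis.RiemannHypothesis.Theorems.Splittings.LiIncrHighPart
open Summit.RiemannHypothesis.RiemannHypothesis.Theorems.Splittings.LiRephasingKit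
open Summit.RiemannHypothesis.RiemannHypothesis.Theorems.Splittings.LiRephasingGainBudget

/-! ## §4 THE ONE-STEP RE-PHASING THEOREM — RH-FREE -/

/-- **ONE-STEP RE-PHASING THEOREM (THEOREM A-fin; RH-FREE).**  Let `g₀ : ℂ → ℝ` be ANY base assignment of ordinates
(e.g. `g₀ ρ = γ`, or the result of earlier steps), `0 ≤ T ≤ T' ≤ Y`, `0 < m`, `0 < N` and `16π T' ≤ N`, and let
`Z = zerosBetween T T'` (the zone).  Then there are an index `n ∈ [N, 2N)`, a rank class `c < m` and a re-phasing `g`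
which agrees with `g₀` OFF `sel Z m c` (every `m`-th zero of the zone) and moves each selected zero from its TRUE ordinate
`γ` DOWNWARD by at most `4πγ²/(n+½)`, such that the re-phased low sum satisfies
`lowSumRe g n Y ≤ 4·(Σ_{0<γ≤Y} m_ρ)/N − (1/m)·Σ_{ρ∈Z} m_ρ · 4 sin(θ_γ/2)`.
Ingredients: pigeonhole (§3), no drift of the unmoved family on `[N,2N)` WHATEVER its phases `g₀` (§1), downward
alignment of every moved zero to `sin((n+½)θ) = −1` with amplitude `≥` its true amplitude (§2).  About the TRUE zeta
zeros; no hypothesis on their real parts; `g₀` arbitrary (so the steps CHAIN over disjoint zones). RH-FREE. -/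
theorem one_step (g₀ : ℂ → ℝ) {T T' Y : ℝ} (hT : 0 ≤ T) (hTT' : T ≤ T') (hT'Y : T' ≤ Y) {m N : ℕ}
    (hm : 0 < m) (hN : 0 < N) (hreach : 16 * π * T' ≤ (N : ℝ)) :
    ∃ n ∈ Finset.Ico N (2 * N), ∃ c < m, ∃ g : ℂ → ℝ,
      (∀ ρ, ρ ∉ sel (zerosBetween T T') m c → g ρ = g₀ ρ) ∧
      (∀ ρ ∈ sel (zerosBetween T T') m c,
        ρ.im - 4 * π * ρ.im ^ 2 / ((n : ℝ) + 1 / 2) ≤ g ρ ∧ g ρ ≤ ρ.im) ∧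
      lowSumRe g n Y ≤ 4 * (∑ ρ ∈ zerosBetween 0 Y, mult ρ) / N
        - (∑ ρ ∈ zerosBetween T T', mult ρ * (4 * Real.sin (liZeroAngle ρ.im / 2))) / m := by
  classical
  have hZsub : zerosBetween T T' ⊆ zerosBetween 0 Y := by
    intro ρ hρ
    obtain ⟨hz, h1, h2, h3, h4⟩ := (mem_zerosBetween hT).1 hρ
    exact (mem_zerosBetween le_rfl).2 ⟨hz, h1, h2, hT.trans_lt h3, h4.trans hT'Y⟩
  -- (1) the class, by pigeonhole (independent of `n`)
  obtain ⟨c, hc, hcsum⟩ :=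
    exists_sel_ge (zerosBetween T T') (fun ρ ↦ mult ρ * (4 * Real.sin (liZeroAngle ρ.im / 2))) hm
  have hSsub : sel (zerosBetween T T') m c ⊆ zerosBetween T T' := sel_subset _ _ _
  -- (2) the index, by averaging the UNMOVED family over `[N, 2N)`
  have hCw : ∀ ρ ∈ (zerosBetween 0 Y).filter (fun ρ ↦ ρ ∉ sel (zerosBetween T T') m c), 0 ≤ mult ρ :=
    fun ρ hρ ↦ zeroOrder_nonneg_of_mem_zerosBetween le_rfl (Finset.mem_filter.1 hρ).1
  obtain ⟨i, hi, hile⟩ := exists_index_le ((zerosBetween 0 Y).filter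
    (fun ρ ↦ ρ ∉ sel (zerosBetween T T') m c)) mult (fun ρ ↦ liZeroAngle (g₀ ρ)) hCw hN
  have hiN : i < N := Finset.mem_range.1 hi
  have hCle : ∑ ρ ∈ (zerosBetween 0 Y).filter (fun ρ ↦ ρ ∉ sel (zerosBetween T T') m c), mult ρ ≤
      ∑ ρ ∈ zerosBetween 0 Y, mult ρ :=
    Finset.sum_le_sum_of_subset_of_nonneg (Finset.filter_subset _ _)
      (fun ρ hρ _ ↦ zeroOrder_nonneg_of_mem_zerosBetween le_rfl hρ)
  -- (3) the re-phasing, by downward alignment of every selected zero at the index `N + i`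
  have hreal : ∀ ρ : ℂ, ∃ x' : ℝ,
      (ρ ∈ sel (zerosBetween T T') m c →
        ρ.im - 4 * π * ρ.im ^ 2 / (((N + i : ℕ) : ℝ) + 1 / 2) ≤ x' ∧ x' ≤ ρ.im ∧ 1 ≤ x' ∧
          Real.sin ((((N + i : ℕ) : ℝ) + 1 / 2) * liZeroAngle x') = -1) ∧
      (ρ ∉ sel (zerosBetween T T') m c → x' = g₀ ρ) := by
    intro ρ
    by_cases h : ρ ∈ sel (zerosBetween T T') m c
    · have hρZ : ρ ∈ zerosBetween T T' := hSsub h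
      obtain ⟨-, -, -, -, h4⟩ := (mem_zerosBetween hT).1 hρZ
      have h14 : 14 < ρ.im := LiLowZeroBudget.fourteen_lt_im (hZsub hρZ)
      have hNn : (N : ℝ) ≤ ((N + i : ℕ) : ℝ) := by exact_mod_cast Nat.le_add_right N i
      have hnρ : 16 * π * ρ.im ≤ ((N + i : ℕ) : ℝ) + 1 / 2 := by nlinarith [Real.pi_pos]
      obtain ⟨x', h1, h2, h3, h5⟩ := exists_realign_down_sq (N + i) h14 hnρ
      exact ⟨x', fun _ ↦ ⟨h1, h2, h3, h5⟩, fun h' ↦ absurd h h'⟩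
    · exact ⟨g₀ ρ, fun h' ↦ absurd h' h, fun _ ↦ rfl⟩
  choose g hg using hreal
  refine ⟨N + i, Finset.mem_Ico.2 ⟨by omega, by omega⟩, c, hc, g, fun ρ hρ ↦ (hg ρ).2 hρ,
    fun ρ hρ ↦ ⟨((hg ρ).1 hρ).1, ((hg ρ).1 hρ).2.1⟩, ?_⟩
  -- (4) the estimate: moved part ≤ −(class mass), unmoved part ≤ average
  have hfS : (zerosBetween 0 Y).filter (fun ρ ↦ ρ ∈ sel (zerosBetween T T') m c) =
      sel (zerosBetween T T') m c := by
    ext ρ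
    simp only [Finset.mem_filter]
    exact ⟨fun h ↦ h.2, fun h ↦ ⟨hZsub (hSsub h), h⟩⟩
  have hmoved : ∑ ρ ∈ sel (zerosBetween T T') m c,
      mult ρ * (4 * Real.sin (liZeroAngle (g ρ) / 2) *
        Real.sin ((((N + i : ℕ) : ℝ) + 1 / 2) * liZeroAngle (g ρ))) ≤
      -∑ ρ ∈ sel (zerosBetween T T') m c, mult ρ * (4 * Real.sin (liZeroAngle ρ.im / 2)) := by
    rw [← Finset.sum_neg_distrib]
    refine Finset.sum_le_sum fun ρ hρ ↦ ?_
    obtain ⟨-, h2, h3, h5⟩ := (hg ρ).1 hρ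
    have hm0 : 0 ≤ mult ρ := zeroOrder_nonneg_of_mem_zerosBetween hT (hSsub hρ)
    have hamp : Real.sin (liZeroAngle ρ.im / 2) ≤ Real.sin (liZeroAngle (g ρ) / 2) :=
      sin_half_angle_mono (by linarith) h2
    rw [h5]
    nlinarith [mul_le_mul_of_nonneg_left hamp hm0]
  have hunmoved : ∑ ρ ∈ (zerosBetween 0 Y).filter (fun ρ ↦ ρ ∉ sel (zerosBetween T T') m c),
      mult ρ * (4 * Real.sin (liZeroAngle (g ρ) / 2) *
        Real.sin ((((N + i : ℕ) : ℝ) + 1 / 2) * liZeroAngle (g ρ))) =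
      ∑ ρ ∈ (zerosBetween 0 Y).filter (fun ρ ↦ ρ ∉ sel (zerosBetween T T') m c),
        mult ρ * (4 * Real.sin (liZeroAngle (g₀ ρ) / 2) *
          Real.sin ((((N + i : ℕ) : ℝ) + 1 / 2) * liZeroAngle (g₀ ρ))) := by
    refine Finset.sum_congr rfl fun ρ hρ ↦ ?_
    rw [(hg ρ).2 (Finset.mem_filter.1 hρ).2]
  have hN0 : (0 : ℝ) < N := by exact_mod_cast hN
  have hC4 : 4 * (∑ ρ ∈ (zerosBetween 0 Y).filter (fun ρ ↦ ρ ∉ sel (zerosBetween T T') m c), mult ρ) / N ≤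
      4 * (∑ ρ ∈ zerosBetween 0 Y, mult ρ) / N := by
    gcongr
  unfold lowSumRe
  rw [← Finset.sum_filter_add_sum_filter_not (zerosBetween 0 Y) (fun ρ ↦ ρ ∈ sel (zerosBetween T T') m c), hfS,
    hunmoved]
  linarith [hmoved, hile, hcsum, hC4]

/-! ## §5 The one-step theorem with the gain budget; floor violations; size of the displacement -/

/-- **ONE-STEP THEOREM WITH THE GAIN BUDGET (RH-FREE).**  Zone `(T, 2^J T]`, `T ≥ 260`:
`lowSumRe g n Y ≤ 4M(Y)/N − (J·log(T/2π) + log 2·J(J−1)/2)/(13 m)` for some `n ∈ [N,2N)`, some class `c < m` and a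
re-phasing `g` moving only `sel Z m c`, downward by `≤ 4πγ²/(n+½)` (`one_step` + `gain_budget_ge`). RH-FREE. -/
theorem one_step_budget (g₀ : ℂ → ℝ) {T Y : ℝ} (hT : 260 ≤ T) (J : ℕ) (hY : 2 ^ J * T ≤ Y) {m N : ℕ}
    (hm : 0 < m) (hN : 0 < N) (hreach : 16 * π * (2 ^ J * T) ≤ (N : ℝ)) :
    ∃ n ∈ Finset.Ico N (2 * N), ∃ c < m, ∃ g : ℂ → ℝ,
      (∀ ρ, ρ ∉ sel (zerosBetween T (2 ^ J * T)) m c → g ρ = g₀ ρ) ∧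
      (∀ ρ ∈ sel (zerosBetween T (2 ^ J * T)) m c,
        ρ.im - 4 * π * ρ.im ^ 2 / ((n : ℝ) + 1 / 2) ≤ g ρ ∧ g ρ ≤ ρ.im) ∧
      lowSumRe g n Y ≤ 4 * (∑ ρ ∈ zerosBetween 0 Y, mult ρ) / N
        - (J * Real.log (T / (2 * π)) + Real.log 2 * (J * (J - 1) / 2)) / (13 * m) := by
  have hT0 : 0 ≤ T := by linarith
  have hTT : T ≤ 2 ^ J * T := by
    have : (1 : ℝ) ≤ 2 ^ J := one_le_pow₀ (by norm_num)
    nlinarith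
  obtain ⟨n, hn, c, hc, g, hg1, hg2, hle⟩ := one_step g₀ hT0 hTT hY hm hN hreach
  refine ⟨n, hn, c, hc, g, hg1, hg2, hle.trans ?_⟩
  have hb := gain_budget_ge hT J
  have hm0 : (0 : ℝ) < m := by exact_mod_cast hm
  have hdiv : (J * Real.log (T / (2 * π)) + Real.log 2 * (J * (J - 1) / 2)) / (13 * m) ≤
      (∑ ρ ∈ zerosBetween T (2 ^ J * T), mult ρ * (4 * Real.sin (liZeroAngle ρ.im / 2))) / m := by
    rw [div_le_div_iff₀ (by positivity) hm0]
    calc (J * Real.log (T / (2 * π)) + Real.log 2 * (J * (J - 1) / 2)) * m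
        = (J * Real.log (T / (2 * π)) + Real.log 2 * (J * (J - 1) / 2)) / 13 * (13 * m) := by ring
      _ ≤ _ := mul_le_mul_of_nonneg_right hb (by positivity)
  linarith

/-- **FLOOR VIOLATION (RH-FREE).**  Any prescribed floor `−A` is violated by the re-phased low sum at some `n ∈ [N, 2N)`
as soon as the budget inequality `13 m (A + 4M(Y)/N) ≤ J·log(T/2π) + log 2·J(J−1)/2` holds. RH-FREE. -/
theorem floor_violation (g₀ : ℂ → ℝ) {T Y A : ℝ} (hT : 260 ≤ T) (J : ℕ) (hY : 2 ^ J * T ≤ Y) {m N : ℕ}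
    (hm : 0 < m) (hN : 0 < N) (hreach : 16 * π * (2 ^ J * T) ≤ (N : ℝ))
    (hbudget : 13 * m * (A + 4 * (∑ ρ ∈ zerosBetween 0 Y, mult ρ) / N) ≤
      J * Real.log (T / (2 * π)) + Real.log 2 * (J * (J - 1) / 2)) :
    ∃ n ∈ Finset.Ico N (2 * N), ∃ c < m, ∃ g : ℂ → ℝ,
      (∀ ρ, ρ ∉ sel (zerosBetween T (2 ^ J * T)) m c → g ρ = g₀ ρ) ∧
      (∀ ρ ∈ sel (zerosBetween T (2 ^ J * T)) m c,
        ρ.im - 4 * π * ρ.im ^ 2 / ((n : ℝ) + 1 / 2) ≤ g ρ ∧ g ρ ≤ ρ.im) ∧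
      lowSumRe g n Y ≤ -A := by
  obtain ⟨n, hn, c, hc, g, hg1, hg2, hle⟩ := one_step_budget g₀ hT J hY hm hN hreach
  refine ⟨n, hn, c, hc, g, hg1, hg2, hle.trans ?_⟩
  have hm0 : (0 : ℝ) < m := by exact_mod_cast hm
  have h13 : (0 : ℝ) < 13 * m := by positivity
  have hA : A + 4 * (∑ ρ ∈ zerosBetween 0 Y, mult ρ) / N ≤
      (J * Real.log (T / (2 * π)) + Real.log 2 * (J * (J - 1) / 2)) / (13 * m) := by
    rw [le_div_iff₀ h13]
    linarith
  linarith

/-- **FLOOR VIOLATION, PL-shaped floor (RH-FREE).**  With `A = ½ log(2N) − K + 1` the re-phased low sum drops STRICTLY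
below the PL-floor `K − ½ log n` at some `n ∈ [N, 2N)` (`log n ≤ log 2N`).  A statement about the RE-PHASED sum only. -/
theorem floor_violation_log (g₀ : ℂ → ℝ) {T Y K : ℝ} (hT : 260 ≤ T) (J : ℕ) (hY : 2 ^ J * T ≤ Y) {m N : ℕ}
    (hm : 0 < m) (hN : 0 < N) (hreach : 16 * π * (2 ^ J * T) ≤ (N : ℝ))
    (hbudget : 13 * m * (Real.log (2 * N) / 2 - K + 1 + 4 * (∑ ρ ∈ zerosBetween 0 Y, mult ρ) / N) ≤
      J * Real.log (T / (2 * π)) + Real.log 2 * (J * (J - 1) / 2)) :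
    ∃ n ∈ Finset.Ico N (2 * N), ∃ c < m, ∃ g : ℂ → ℝ,
      (∀ ρ, ρ ∉ sel (zerosBetween T (2 ^ J * T)) m c → g ρ = g₀ ρ) ∧
      (∀ ρ ∈ sel (zerosBetween T (2 ^ J * T)) m c,
        ρ.im - 4 * π * ρ.im ^ 2 / ((n : ℝ) + 1 / 2) ≤ g ρ ∧ g ρ ≤ ρ.im) ∧
      lowSumRe g n Y < K - Real.log n / 2 := by
  obtain ⟨n, hn, c, hc, g, hg1, hg2, hle⟩ := floor_violation g₀ hT J hY hm hN hreach hbudget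
  refine ⟨n, hn, c, hc, g, hg1, hg2, ?_⟩
  obtain ⟨hNn, hn2⟩ := Finset.mem_Ico.1 hn
  have hn0 : (0 : ℝ) < n := by exact_mod_cast hN.trans_le hNn
  have hlog : Real.log n ≤ Real.log (2 * N) :=
    Real.log_le_log hn0 (by exact_mod_cast hn2.le)
  linarith

/-- **SIZE OF THE DISPLACEMENT (PURE).**  In the decorrelated zone `32 x² log x ≤ n + ½` (`x > 1`) the downward
displacement `4πx²/(n+½)` is at most `1/16` of `2π/log x` (itself below the mean spacing `2π/log(x/2π)` of the zeros at
height `x`). -/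
theorem disp_le_spacing_div {x : ℝ} {n : ℕ} (hx : 1 < x) (h : 32 * x ^ 2 * Real.log x ≤ (n : ℝ) + 1 / 2) :
    4 * π * x ^ 2 / ((n : ℝ) + 1 / 2) ≤ 2 * π / Real.log x / 16 := by
  have hl : 0 < Real.log x := Real.log_pos hx
  have hx0 : 0 < x := by linarith
  calc 4 * π * x ^ 2 / ((n : ℝ) + 1 / 2) ≤ 4 * π * x ^ 2 / (32 * x ^ 2 * Real.log x) :=
        div_le_div_of_nonneg_left (by positivity) (by positivity) h
    _ = 2 * π / Real.log x / 16 := by field_simp; ring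

/-- … and at most `1` as soon as moreover `x ≥ 2` (`π/(8 log 2) < 1`). PURE. -/
theorem disp_le_one {x : ℝ} {n : ℕ} (hx : 2 ≤ x) (h : 32 * x ^ 2 * Real.log x ≤ (n : ℝ) + 1 / 2) :
    4 * π * x ^ 2 / ((n : ℝ) + 1 / 2) ≤ 1 := by
  have h1 := disp_le_spacing_div (by linarith) h
  have hl2 : Real.log 2 ≤ Real.log x := Real.log_le_log (by norm_num) hx
  have hl : (0.6931471803 : ℝ) < Real.log x := Real.log_two_gt_d9.trans_le hl2
  have hπ := Real.pi_lt_d2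
  have h2 : 2 * π / Real.log x / 16 ≤ 1 := by
    rw [div_div, div_le_one (by positivity)]
    nlinarith
  linarith

/-- The amplitude is at most `2/t`: `4 sin(θ_t/2) ≤ 2θ_t ≤ 2/t` (`sin y ≤ y`, tree `liZeroAngle_bounds`). PURE. -/
theorem amp_le_two_div {t : ℝ} (ht : 0 < t) : 4 * Real.sin (liZeroAngle t / 2) ≤ 2 / t := by
  obtain ⟨h0, h1⟩ := SmoothReplace.liZeroAngle_bounds ht
  have hs : Real.sin (liZeroAngle t / 2) ≤ liZeroAngle t / 2 := Real.sin_le (by linarith)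
  have e : 2 / t = 2 * (1 / t) := by ring
  rw [e]
  linarith

/-- One re-phased term is at most `(2/Y)·m_ρ` once its assigned ordinate is `≥ Y > 0`. PURE. -/
theorem term_le {g : ℂ → ℝ} {ρ : ℂ} (n : ℕ) {Y : ℝ} (hY : 0 < Y) (hg : Y ≤ g ρ) (hm : 0 ≤ mult ρ) :
    mult ρ * (4 * Real.sin (liZeroAngle (g ρ) / 2) * Real.sin (((n : ℝ) + 1 / 2) * liZeroAngle (g ρ))) ≤
      2 / Y * mult ρ := by
  have hgpos : 0 < g ρ := hY.trans_le hg
  have hamp0 : 0 ≤ 4 * Real.sin (liZeroAngle (g ρ) / 2) := by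
    linarith [amp_ge hgpos, show (0 : ℝ) < 4 / (2 * g ρ + 1) by positivity]
  have hamp : 4 * Real.sin (liZeroAngle (g ρ) / 2) ≤ 2 / Y :=
    (amp_le_two_div hgpos).trans (div_le_div_of_nonneg_left (by norm_num) hY hg)
  have hs : Real.sin (((n : ℝ) + 1 / 2) * liZeroAngle (g ρ)) ≤ 1 := Real.sin_le_one _
  calc mult ρ * (4 * Real.sin (liZeroAngle (g ρ) / 2) * Real.sin (((n : ℝ) + 1 / 2) * liZeroAngle (g ρ)))
      ≤ mult ρ * (4 * Real.sin (liZeroAngle (g ρ) / 2) * 1) := by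
        gcongr
    _ ≤ mult ρ * (2 / Y) := by rw [mul_one]; exact mul_le_mul_of_nonneg_left hamp hm
    _ = 2 / Y * mult ρ := mul_comm _ _

/-- **CUT MONOTONICITY (PURE / RH-FREE).**  Raising the cut from `Y` to `Y'` (`0 < Y ≤ Y'`) raises a re-phased low sum
by at most the amplitude mass of the added zeros, `≤ (2/Y)·Σ_{Y<γ≤Y'} m_ρ`, provided their assigned ordinates are `≥ Y`
(e.g. unmoved).  With the PL cut `Y_n = √n log n` on a block `[N, 2N)` this bounds the «cut drift» between `Y_N` and `Y_n`
by `(2/Y_N)·(N(Y_{2N}) − N(Y_N))` (`∼ 0.07 log N` by Riemann–von Mangoldt — PAPER; `≤ 1.3 log N + O(1)` from the tree's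
unit windows `LiLowZeroBudget.sum_mult_window_le`). -/
theorem lowSumRe_cut_le (g : ℂ → ℝ) (n : ℕ) {Y Y' : ℝ} (hY : 0 < Y) (hYY : Y ≤ Y')
    (hg : ∀ ρ ∈ zerosBetween Y Y', Y ≤ g ρ) :
    lowSumRe g n Y' ≤ lowSumRe g n Y + 2 / Y * ∑ ρ ∈ zerosBetween Y Y', mult ρ := by
  unfold lowSumRe
  rw [sum_zerosBetween_split le_rfl hY.le hYY, Finset.mul_sum]
  have h : ∑ ρ ∈ zerosBetween Y Y',
      mult ρ * (4 * Real.sin (liZeroAngle (g ρ) / 2) * Real.sin (((n : ℝ) + 1 / 2) * liZeroAngle (g ρ))) ≤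
      ∑ ρ ∈ zerosBetween Y Y', 2 / Y * mult ρ :=
    Finset.sum_le_sum fun ρ hρ ↦ term_le n hY (hg ρ hρ) (zeroOrder_nonneg_of_mem_zerosBetween hY.le hρ)
  linarith

/-! ## §6 Counting invisibility — RH-FREE -/

/-- The counting function of a (re-phased) finite configuration: the multiplicity mass of the zeros of
`zerosBetween 0 Y` whose assigned ordinate is `≤ t`. -/
noncomputable def countRe (g : ℂ → ℝ) (Y t : ℝ) : ℝ :=
  ∑ ρ ∈ (zerosBetween 0 Y).filter (fun ρ ↦ g ρ ≤ t), mult ρ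

/-- **COUNTING INVISIBILITY (RH-FREE).**  If a re-phasing lowers every ordinate by at most `1`
(`γ − 1 ≤ g ρ ≤ γ` on `zerosBetween 0 Y`), then for every `t ≥ 0` its counting function is squeezed between the true one
and the true one plus ONE UNIT WINDOW: `N(t) ≤ N_g(t) ≤ N(t) + Σ_{t<γ≤t+1} m_ρ ≤ N(t) + 3 log(t+2)`
(tree `LiLowZeroBudget.sum_mult_window_le`).  Every counting law with resolution `O(log t)` — Riemann–von Mangoldt with its
`O(log T)` term, `S(T) = O(log T)`, window counts — holds for the re-phased configuration iff it holds for the true one. -/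
theorem countRe_squeeze {g : ℂ → ℝ} {Y : ℝ}
    (hg : ∀ ρ ∈ zerosBetween 0 Y, ρ.im - 1 ≤ g ρ ∧ g ρ ≤ ρ.im) {t : ℝ} (ht : 0 ≤ t) :
    countRe (fun ρ ↦ ρ.im) Y t ≤ countRe g Y t ∧
      countRe g Y t ≤ countRe (fun ρ ↦ ρ.im) Y t + 3 * Real.log (t + 2) := by
  have hw : ∀ ρ ∈ zerosBetween 0 Y, 0 ≤ mult ρ := fun ρ hρ ↦ zeroOrder_nonneg_of_mem_zerosBetween le_rfl hρ
  constructor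
  · -- `{γ ≤ t} ⊆ {g ≤ t}`
    refine Finset.sum_le_sum_of_subset_of_nonneg ?_ (fun ρ hρ _ ↦ hw ρ (Finset.mem_filter.1 hρ).1)
    intro ρ hρ
    rw [Finset.mem_filter] at hρ ⊢
    exact ⟨hρ.1, (hg ρ hρ.1).2.trans hρ.2⟩
  · -- `{g ≤ t} ⊆ {γ ≤ t} ∪ {t < γ ≤ t+1}` and the window bound
    have hsub : (zerosBetween 0 Y).filter (fun ρ ↦ g ρ ≤ t) ⊆
        (zerosBetween 0 Y).filter (fun ρ ↦ ρ.im ≤ t) ∪ zerosBetween t (t + 1) := by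
      intro ρ hρ
      rw [Finset.mem_filter] at hρ
      rw [Finset.mem_union, Finset.mem_filter]
      by_cases hle : ρ.im ≤ t
      · exact Or.inl ⟨hρ.1, hle⟩
      · right
        obtain ⟨hz, h1, h2, -, -⟩ := (mem_zerosBetween le_rfl).1 hρ.1
        exact (mem_zerosBetween ht).2 ⟨hz, h1, h2, not_le.1 hle, by linarith [(hg ρ hρ.1).1, hρ.2]⟩
    have hwin : ∑ ρ ∈ zerosBetween t (t + 1), mult ρ ≤ 3 * Real.log (t + 2) :=
      LiLowZeroBudget.sum_mult_window_le ht
    calc countRe g Y t ≤ ∑ ρ ∈ (zerosBetween 0 Y).filter (fun ρ ↦ ρ.im ≤ t) ∪ zerosBetween t (t + 1), mult ρ := by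
          refine Finset.sum_le_sum_of_subset_of_nonneg hsub fun ρ hρ _ ↦ ?_
          rcases Finset.mem_union.1 hρ with h | h
          · exact hw ρ (Finset.mem_filter.1 h).1
          · exact zeroOrder_nonneg_of_mem_zerosBetween ht h
      _ ≤ ∑ ρ ∈ (zerosBetween 0 Y).filter (fun ρ ↦ ρ.im ≤ t), mult ρ + ∑ ρ ∈ zerosBetween t (t + 1), mult ρ := by
          have hui := Finset.sum_union_inter (s₁ := (zerosBetween 0 Y).filter (fun ρ ↦ ρ.im ≤ t))
            (s₂ := zerosBetween t (t + 1)) (f := mult)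
          have hint : 0 ≤ ∑ ρ ∈ (zerosBetween 0 Y).filter (fun ρ ↦ ρ.im ≤ t) ∩ zerosBetween t (t + 1), mult ρ :=
            Finset.sum_nonneg fun ρ hρ ↦ hw ρ (Finset.mem_filter.1 (Finset.mem_inter.1 hρ).1).1
          linarith
      _ ≤ countRe (fun ρ ↦ ρ.im) Y t + 3 * Real.log (t + 2) := by
          unfold countRe
          beta_reduce
          linarith

end Summit.RiemannHypothesis.RiemannHypothesis.Theorems.Splittings.LiOneStepRephasing
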